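import Summits.NavierStokesRegularity.NavierStokesRegularity.Theorems.FilamentSkeletonRssExchangeDefs

/-!
# Route `FilamentSkeletonRss` — exchange-certificate API, I: path upper bounds and the
# Freidlin–Wentzell BARRIER LOWER BOUND for the quasipotential

First tools for the two re-seamed cruxes that share `FilamentExchange.ExchangeCertificate`
(`CertifiedSelectionBox` must CERTIFY action gaps on the skeleton; `SignedTransverseReduction` must
turn them into signs): an inequality between two infima `e_j + g₀ ≤ i_j` is certified by an explicit
admissible path (UPPER bound on an infimum — `qPot_le_of_path`, `qPot_self`) together with a
Hamilton–Jacobi SUB-SOLUTION (LOWER bound on an infimum — `le_fwAction_of_subsolution`,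
`le_qPot_of_subsolution`):

* if `ψ` is `C¹` with `⟪∇ψ, W⟫ + ‖∇ψ‖² ≤ 0` on `S`, then every `C¹` path `φ : [0,T] → S` has
  `ψ(φ T) − ψ(φ 0) ≤ ∫₀ᵀ ‖φ′ − W(φ)‖²/4`, hence `ψ y − ψ x ≤ V_S(x → y)`.

Proof: complete the square, `‖a − w‖²/4 − ⟪g, a⟫ = ‖a − w − 2g‖²/4 − (⟪g, w⟫ + ‖g‖²) ≥ 0`, and
integrate `d/dt ψ(φ t) = ⟪∇ψ(φ t), φ′ t⟫`.  This is the verification half of the Freidlin–Wentzell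
variational formula (the barrier `e^(−ΓV)` comparison of the route's sign analysis is the same
inequality), and the form in which interval arithmetic can certify lower bounds on the certificate's
exponents (supply a polynomial / piecewise `ψ`, check the pointwise HJ inequality on `S`).

## References
* M. I. Freidlin, A. D. Wentzell, *Random Perturbations of Dynamical Systems*, 3rd ed. (2012),
  Ch. 4 §1 and Ch. 6 §1. [FreidlinWentzell2012]
-/

set_option linter.dupNamespace false -- the module path `Summits.NavierStokesRegularity.NavierStokesRegularity.…` repeats a component by layout (D-0017)

noncomputable section

namespace Summit.NavierStokesRegularity.NavierStokesRegularity.Theorems.FilamentExchange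

open scoped Topology ENNReal InnerProductSpace RealInnerProductSpace
open Set Function MeasureTheory

/-- **Upper bound by an explicit path.** Any admissible `C¹` path from `x` to `y` inside `S` bounds
the quasipotential from above by its action. [folklore] -/
theorem qPot_le_of_path {W : (EuclideanSpace ℝ (Fin 3)) → (EuclideanSpace ℝ (Fin 3))} {S : Set (EuclideanSpace ℝ (Fin 3))} {x y : (EuclideanSpace ℝ (Fin 3))} {T : ℝ} {φ : ℝ → (EuclideanSpace ℝ (Fin 3))} (hT : 0 ≤ T)
    (hφ : ContDiff ℝ 1 φ) (h0 : φ 0 = x) (h1 : φ T = y) (hS : ∀ t ∈ Icc 0 T, φ t ∈ S) :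
    qPot W S x y ≤ ENNReal.ofReal (fwAction W T φ) :=
  sInf_le ⟨T, φ, hT, hφ, h0, h1, hS, rfl⟩

/-- The quasipotential from a point of `S` to itself vanishes (constant path, `T = 0`). [folklore] -/
theorem qPot_self {W : (EuclideanSpace ℝ (Fin 3)) → (EuclideanSpace ℝ (Fin 3))} {S : Set (EuclideanSpace ℝ (Fin 3))} {x : (EuclideanSpace ℝ (Fin 3))} (hx : x ∈ S) : qPot W S x x = 0 := by
  refine le_antisymm ?_ bot_le
  have h := qPot_le_of_path (W := W) (S := S) (T := 0) (φ := fun _ => x) le_rfl contDiff_const rfl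
    rfl (fun t _ => hx)
  simpa [fwAction] using h

/-- **Completing the square.** If `⟪g, w⟫ + ‖g‖² ≤ 0` then `⟪g, a⟫ ≤ ‖a − w‖²/4` for every `a`
(`‖a − w‖²/4 − ⟪g,a⟫ = ‖a − w − 2g‖²/4 − (⟪g,w⟫ + ‖g‖²)`). [folklore] -/
theorem inner_le_norm_sub_sq_div_four {g w : (EuclideanSpace ℝ (Fin 3))} (h : ⟪g, w⟫ + ‖g‖ ^ 2 ≤ 0) (a : (EuclideanSpace ℝ (Fin 3))) :
    ⟪g, a⟫ ≤ ‖a - w‖ ^ 2 / 4 := by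
  have h0 : 0 ≤ ‖(a - w) - (2:ℝ) • g‖ ^ 2 := sq_nonneg _
  have hexp : ‖(a - w) - (2:ℝ) • g‖ ^ 2 = ‖a - w‖ ^ 2 - 4 * (⟪g, a⟫ - ⟪g, w⟫) + 4 * ‖g‖ ^ 2 := by
    rw [norm_sub_sq_real, inner_smul_right, inner_sub_left, norm_smul, mul_pow, Real.norm_eq_abs,
      abs_of_pos (by norm_num : (0:ℝ) < 2), real_inner_comm a g, real_inner_comm w g]
    ring
  rw [hexp] at h0
  linarith

/-- **Barrier lower bound for the action.** If `ψ` is `C¹` with `⟪∇ψ(z), W(z)⟫ + ‖∇ψ(z)‖² ≤ 0` for all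
`z ∈ S` (a Hamilton–Jacobi sub-solution for the Freidlin–Wentzell Hamiltonian `⟪p, W⟫ + ‖p‖²`) and
`W` is continuous, then every `C¹` path `φ` with `φ([0,T]) ⊆ S` satisfies
`ψ(φ T) − ψ(φ 0) ≤ ∫₀ᵀ ‖φ′ − W(φ)‖²/4`. [cite: FreidlinWentzell2012, Ch. 4 §1] -/
theorem le_fwAction_of_subsolution {W : (EuclideanSpace ℝ (Fin 3)) → (EuclideanSpace ℝ (Fin 3))} (hW : Continuous W) {S : Set (EuclideanSpace ℝ (Fin 3))} {ψ : (EuclideanSpace ℝ (Fin 3)) → ℝ}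
    (hψ : ContDiff ℝ 1 ψ) (hHJ : ∀ z ∈ S, ⟪gradient ψ z, W z⟫ + ‖gradient ψ z‖ ^ 2 ≤ 0)
    {T : ℝ} (hT : 0 ≤ T) {φ : ℝ → (EuclideanSpace ℝ (Fin 3))} (hφ : ContDiff ℝ 1 φ) (hS : ∀ t ∈ Icc 0 T, φ t ∈ S) :
    ψ (φ T) - ψ (φ 0) ≤ fwAction W T φ := by
  have hψd : Differentiable ℝ ψ := hψ.differentiable one_ne_zero
  have hφd : Differentiable ℝ φ := hφ.differentiable one_ne_zero
  have hφ'c : Continuous (deriv φ) := hφ.continuous_deriv le_rfl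
  -- the derivative of `t ↦ ψ (φ t)`
  have hderiv : ∀ t, HasDerivAt (fun s => ψ (φ s)) (fderiv ℝ ψ (φ t) (deriv φ t)) t := fun t =>
    (hψd (φ t)).hasFDerivAt.comp_hasDerivAt t (hφd t).hasDerivAt
  have hcont : Continuous fun t => fderiv ℝ ψ (φ t) (deriv φ t) :=
    ((hψ.continuous_fderiv one_ne_zero).comp hφ.continuous).clm_apply hφ'c
  have hftc : ∫ t in (0:ℝ)..T, fderiv ℝ ψ (φ t) (deriv φ t) = ψ (φ T) - ψ (φ 0) :=
    intervalIntegral.integral_eq_sub_of_hasDerivAt (fun t _ => hderiv t)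
      (hcont.intervalIntegrable _ _)
  have hcont2 : Continuous fun t => ‖deriv φ t - W (φ t)‖ ^ 2 / 4 :=
    ((hφ'c.sub (hW.comp hφ.continuous)).norm.pow 2).div_const _
  rw [← hftc, fwAction]
  refine intervalIntegral.integral_mono_on hT (hcont.intervalIntegrable _ _)
    (hcont2.intervalIntegrable _ _) fun t ht => ?_
  rw [← inner_gradient_left]
  exact inner_le_norm_sub_sq_div_four (hHJ _ (hS t ht)) _

/-- **Barrier lower bound for the quasipotential** (verification half of the Freidlin–Wentzell
variational formula): under the hypotheses of `le_fwAction_of_subsolution`,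
`ψ y − ψ x ≤ V_S(x → y)` (in `ℝ≥0∞`, via `ENNReal.ofReal`). This is the certifiable form of a LOWER
bound on the exponents `e_j`, `i_j`, `i_j^±` of `ExchangeCertificate`. [cite: FreidlinWentzell2012, Ch. 6 §1] -/
theorem le_qPot_of_subsolution {W : (EuclideanSpace ℝ (Fin 3)) → (EuclideanSpace ℝ (Fin 3))} (hW : Continuous W) {S : Set (EuclideanSpace ℝ (Fin 3))} {ψ : (EuclideanSpace ℝ (Fin 3)) → ℝ}
    (hψ : ContDiff ℝ 1 ψ) (hHJ : ∀ z ∈ S, ⟪gradient ψ z, W z⟫ + ‖gradient ψ z‖ ^ 2 ≤ 0) (x y : (EuclideanSpace ℝ (Fin 3))) :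
    ENNReal.ofReal (ψ y - ψ x) ≤ qPot W S x y := by
  refine le_sInf ?_
  rintro r ⟨T, φ, hT, hφ, h0, h1, hS, rfl⟩
  refine ENNReal.ofReal_le_ofReal ?_
  have h := le_fwAction_of_subsolution hW hψ hHJ hT hφ hS
  rw [h0, h1] at h
  exact h

/-- **Rescaling preserves the tangent.** `(rsCurve Γ Y)′(s) = Y′(√Γ s)` for `Γ > 0` and differentiable
`Y`; in particular unit speed is preserved. [folklore] -/
theorem deriv_rsCurve {Γ : ℝ} (hΓ : 0 < Γ) {Y : ℝ → (EuclideanSpace ℝ (Fin 3))} (hY : Differentiable ℝ Y) (s : ℝ) :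
    deriv (rsCurve Γ Y) s = deriv Y (Real.sqrt Γ * s) := by
  have hsq : Real.sqrt Γ ≠ 0 := (Real.sqrt_pos.2 hΓ).ne'
  have hd : DifferentiableAt ℝ (fun s => Y (Real.sqrt Γ * s)) s :=
    (hY _).comp s (differentiableAt_id.const_mul _)
  show deriv ((Real.sqrt Γ)⁻¹ • fun s => Y (Real.sqrt Γ * s)) s = _
  rw [deriv_const_smul _ hd, deriv_comp_mul_left (Real.sqrt Γ) Y s, smul_smul, inv_mul_cancel₀ hsq,
    one_smul]

end Summit.NavierStokesRegularity.NavierStokesRegularity.Theorems.FilamentExchange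

end
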